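import Mathlib.Topology.Algebra.Category.ProfiniteGrp.Completion
import Literature.NumberTheory.GaloisRepresentations.LocalUnitGroupFiniteIndexOpen
import Literature.NumberTheory.GaloisRepresentations.LocalExistenceTheorem
import HarnessLib

/-!
# The profinite completion of `K^×`: torsion comes from `𝒪_K^×` (theorems only)

Topic `NumberTheory/GaloisRepresentations` (local fields); namespace
`Literature.NumberTheory.GaloisRepresentations`.  No definitions, no named facts.

Let `K` be a non-archimedean local field of characteristic `0`, `U = 𝒪_K^× ≤ K^×` its unit group,
`Ĝ` the profinite completion of the abstract group `K^×` (Mathlib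
`ProfiniteGrp.ProfiniteCompletion.completion`) and `η : K^× → Ĝ` the canonical map.  Classically
`K^× ≅ ℤ × U` with `U` profinite, so `Ĝ ≅ Ẑ × U` (Neukirch, *Algebraic Number Theory*, Ch. II
Prop. (5.7); Serre, *Local Fields*, Ch. XIV §6); we prove the two consequences used for the LCFT
inputs of [AbsAnab] §1.2 (abc-iut layer L4), without constructing the product decomposition:

* `eta_units_injective` — `η` is injective (`K^×` is residually finite).
* `exists_mem_unitGroup_eta_eq_of_isOfFinOrder` — **every torsion element of `Ĝ` is `η u` for
  a (necessarily torsion) unit `u ∈ U`**.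

Method: every `x ∈ K^×` is `u ϖ^k` (`u ∈ U`, `k ∈ ℤ`); the subgroups `N_r = U · ϖ^{rℤ}` have
finite index and `h^n ∈ N_{nr} ⇒ h ∈ N_r`; so a torsion `x ∈ Ĝ` has a representative in `U` at
every finite-index coordinate, and compactness of `U` (`isCompact_unitGroup`) plus openness of
finite-index subgroups (`Subgroup.isOpen_of_finiteIndex_units_localField`) give `u` with `η u = x`.
-/

noncomputable section

open scoped Topology
open ValuativeRel CategoryTheory ProfiniteGrp.ProfiniteCompletion

universe u

namespace Literature.NumberTheory.GaloisRepresentations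

variable (K : Type u) [Field K] [ValuativeRel K] [TopologicalSpace K] [IsNonarchimedeanLocalField K]

/-! ### Uniformiser decomposition `x = u · ϖ^k` -/

omit [TopologicalSpace K] [IsNonarchimedeanLocalField K] in
/-- A uniformiser has valuation `< 1` and `≠ 0`. [folklore] -/
private theorem valuation_uniformizer_lt_one {π : 𝒪[K]} (hπ : Irreducible π) :
    valuation K (π : K) < 1 ∧ valuation K (π : K) ≠ 0 := by
  refine ⟨(Valuation.Integer.not_isUnit_iff_valuation_lt_one (x := π)).1 hπ.not_isUnit, ?_⟩
  rw [Ne, map_eq_zero]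
  exact fun h => hπ.ne_zero (Subtype.ext h)

omit [TopologicalSpace K] [IsNonarchimedeanLocalField K] in
/-- `ϖ^a ∈ U` only for `a = 0` (`ϖ` a uniformiser, `U` the unit group). [folklore] -/
private theorem uniformizer_zpow_mem_unitGroup_iff {π : 𝒪[K]} (hπ : Irreducible π) (hπ0 : (π : K) ≠ 0)
    (a : ℤ) :
    (Units.mk0 (π : K) hπ0) ^ a ∈ (valuation K).valuationSubring.unitGroup ↔ a = 0 := by
  obtain ⟨hlt, hne⟩ := valuation_uniformizer_lt_one K hπ
  constructor
  · intro h
    by_contra ha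
    -- reduce to a positive power
    have key : ∀ b : ℤ, (Units.mk0 (π : K) hπ0) ^ b ∈ (valuation K).valuationSubring.unitGroup →
        0 < b → False := by
      intro b hb hb0
      rw [Valuation.mem_unitGroup_iff] at hb
      obtain ⟨m, rfl⟩ := Int.eq_ofNat_of_zero_le hb0.le
      rw [zpow_natCast, Units.val_pow_eq_pow_val, Units.val_mk0, map_pow] at hb
      have hm : (m : ℕ) ≠ 0 := by omega
      exact (pow_lt_one₀ zero_le hlt hm).ne hb
    rcases lt_or_gt_of_ne ha with hlt0 | hgt0
    · exact key (-a) (by rw [zpow_neg]; exact inv_mem h) (by omega)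
    · exact key a h hgt0
  · rintro rfl
    rw [zpow_zero]
    exact one_mem _

/-- Every `x ∈ K^×` is `u · ϖ^k` with `u ∈ U` and `k ∈ ℤ` (tree `exists_eq_units_mul_zpow`).
[folklore] -/
private theorem exists_mem_unitGroup_mul_uniformizer_zpow {π : 𝒪[K]} (hπ : Irreducible π)
    (hπ0 : (π : K) ≠ 0) (x : Kˣ) :
    ∃ (k : ℤ) (u : Kˣ), u ∈ (valuation K).valuationSubring.unitGroup ∧
      x = u * (Units.mk0 (π : K) hπ0) ^ k := by
  letI : UniformSpace K := IsTopologicalAddGroup.rightUniformSpace K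
  haveI : IsUniformAddGroup K := isUniformAddGroup_of_addCommGroup
  obtain ⟨k, u, hu⟩ := exists_eq_units_mul_zpow K hπ x
  refine ⟨k, Units.map ((𝒪[K]).subtype : 𝒪[K] →* K) u, ?_, ?_⟩
  · rw [Valuation.mem_unitGroup_iff]
    exact Valuation.Integers.one_of_isUnit (Valuation.integer.integers _) u.isUnit
  · ext
    rw [Units.val_mul, Units.val_zpow_eq_zpow_val, Units.val_mk0]
    exact hu

/-! ### The finite-index subgroups `N_r = U · ϖ^{rℤ}` -/

omit [TopologicalSpace K] [IsNonarchimedeanLocalField K] in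
/-- Membership in `N_r = U ⊔ ⟨ϖ^r⟩`: `x = u · ϖ^{r j}`. [folklore] -/
private theorem mem_unitGroup_sup_zpowers_iff {π : 𝒪[K]} (hπ0 : (π : K) ≠ 0) (r : ℕ) (x : Kˣ) :
    x ∈ (valuation K).valuationSubring.unitGroup ⊔
        Subgroup.zpowers ((Units.mk0 (π : K) hπ0) ^ r) ↔
      ∃ u ∈ (valuation K).valuationSubring.unitGroup, ∃ j : ℤ,
        x = u * (Units.mk0 (π : K) hπ0) ^ ((r : ℤ) * j) := by
  rw [Subgroup.mem_sup]
  constructor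
  · rintro ⟨u, hu, z, hz, rfl⟩
    obtain ⟨j, rfl⟩ := Subgroup.mem_zpowers_iff.1 hz
    exact ⟨u, hu, j, by rw [← zpow_natCast, ← zpow_mul]⟩
  · rintro ⟨u, hu, j, rfl⟩
    exact ⟨u, hu, _, Subgroup.mem_zpowers_iff.2 ⟨j, by rw [← zpow_natCast, ← zpow_mul]⟩, rfl⟩

/-- `N_r` has finite index: `K^×/N_r` is covered by the classes of `ϖ^i`, `0 ≤ i < r`. [folklore] -/
private theorem finite_quotient_unitGroup_sup_zpowers {π : 𝒪[K]} (hπ : Irreducible π) (hπ0 : (π : K) ≠ 0)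
    {r : ℕ} (hr : r ≠ 0) :
    Finite (Kˣ ⧸ ((valuation K).valuationSubring.unitGroup ⊔
      Subgroup.zpowers ((Units.mk0 (π : K) hπ0) ^ r))) := by
  set ϖ : Kˣ := Units.mk0 (π : K) hπ0 with hϖ
  set N := (valuation K).valuationSubring.unitGroup ⊔ Subgroup.zpowers (ϖ ^ r) with hN
  refine Finite.of_surjective (fun i : Fin r => (QuotientGroup.mk (ϖ ^ (i : ℕ)) : Kˣ ⧸ N)) ?_
  intro q
  obtain ⟨x, rfl⟩ := QuotientGroup.mk_surjective q
  obtain ⟨k, u, hu, rfl⟩ := exists_mem_unitGroup_mul_uniformizer_zpow K hπ hπ0 x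
  have hr0 : (0 : ℤ) < r := by exact_mod_cast Nat.pos_of_ne_zero hr
  have h1 := Int.emod_lt_of_pos k hr0
  have h2 := Int.emod_nonneg k hr0.ne'
  refine ⟨⟨(k % r).toNat, (Int.toNat_lt h2).2 h1⟩, ?_⟩
  change (QuotientGroup.mk (ϖ ^ ((k % r).toNat : ℕ)) : Kˣ ⧸ N) = QuotientGroup.mk (u * ϖ ^ k)
  rw [QuotientGroup.eq, hN, mem_unitGroup_sup_zpowers_iff K hπ0, ← hϖ]
  refine ⟨u, hu, k / r, ?_⟩
  have hk : ((k % r).toNat : ℤ) = k % r := Int.toNat_of_nonneg h2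
  rw [← zpow_natCast, hk]
  have hdiv := Int.emod_add_mul_ediv k (r : ℤ)
  -- `(ϖ^(k % r))⁻¹ * (u * ϖ^k) = u * ϖ^(r * (k / r))`
  rw [mul_comm u (ϖ ^ k), ← mul_assoc, ← zpow_neg, ← zpow_add, mul_comm _ u]
  congr 2
  linarith [hdiv, mul_comm (r : ℤ) (k / r)]

/-- The key divisibility step: `h^n ∈ N_{nr} ⇒ h ∈ N_r`. [folklore] -/
private theorem mem_unitGroup_sup_zpowers_of_pow_mem {π : 𝒪[K]} (hπ : Irreducible π) (hπ0 : (π : K) ≠ 0)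
    {n r : ℕ} (hn : n ≠ 0) {h : Kˣ}
    (hh : h ^ n ∈ (valuation K).valuationSubring.unitGroup ⊔
      Subgroup.zpowers ((Units.mk0 (π : K) hπ0) ^ (n * r))) :
    h ∈ (valuation K).valuationSubring.unitGroup ⊔
      Subgroup.zpowers ((Units.mk0 (π : K) hπ0) ^ r) := by
  set ϖ : Kˣ := Units.mk0 (π : K) hπ0 with hϖ
  obtain ⟨k, u, hu, rfl⟩ := exists_mem_unitGroup_mul_uniformizer_zpow K hπ hπ0 h
  rw [mem_unitGroup_sup_zpowers_iff K hπ0, ← hϖ] at hh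
  obtain ⟨u', hu', j, hj⟩ := hh
  push_cast at hj
  -- `ϖ^(n k - n r j) = u' / u^n ∈ U`, hence `n k = n r j`
  have hmem : ϖ ^ ((n : ℤ) * k - (n : ℤ) * r * j) ∈ (valuation K).valuationSubring.unitGroup := by
    have h1 : (u * ϖ ^ k) ^ n = u ^ n * ϖ ^ ((n : ℤ) * k) := by
      rw [mul_pow, ← zpow_natCast (ϖ ^ k), ← zpow_mul, mul_comm k]
    rw [h1] at hj
    have h2 : ϖ ^ ((n : ℤ) * k - (n : ℤ) * r * j) = (u ^ n)⁻¹ * u' :=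
      calc ϖ ^ ((n : ℤ) * k - (n : ℤ) * r * j)
          = ϖ ^ ((n : ℤ) * k) * (ϖ ^ ((n : ℤ) * r * j))⁻¹ := by rw [zpow_sub]
        _ = (u ^ n)⁻¹ * (u ^ n * ϖ ^ ((n : ℤ) * k)) * (ϖ ^ ((n : ℤ) * r * j))⁻¹ := by
            rw [inv_mul_cancel_left]
        _ = (u ^ n)⁻¹ * (u' * ϖ ^ ((n : ℤ) * r * j)) * (ϖ ^ ((n : ℤ) * r * j))⁻¹ := by rw [hj]
        _ = (u ^ n)⁻¹ * u' := by rw [mul_assoc, mul_inv_cancel_right]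
    rw [h2]
    exact mul_mem (inv_mem (pow_mem hu n)) hu'
  rw [uniformizer_zpow_mem_unitGroup_iff K hπ hπ0] at hmem
  have hk : k = (r : ℤ) * j := by
    have hn' : (n : ℤ) ≠ 0 := by exact_mod_cast hn
    have : (n : ℤ) * (k - r * j) = 0 := by rw [← hmem]; ring
    rcases mul_eq_zero.1 this with h | h
    · exact absurd h hn'
    · linarith
  rw [mem_unitGroup_sup_zpowers_iff K hπ0]
  exact ⟨u, hu, j, by rw [hk]⟩

/-! ### Torsion of the profinite completion of `K^×` -/

/-- A non-archimedean local field is Hausdorff (the valuative topology separates `0` from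
`x ≠ 0` by the ball `{v < v(x)}`). [folklore] -/
private theorem t2Space_of_isNonarchimedeanLocalField' : T2Space K := by
  apply IsTopologicalAddGroup.t2Space_of_zero_sep
  intro x hx
  refine ⟨{ z | valuation K z < valuation K x }, ?_, by simp⟩
  rw [IsValuativeTopology.mem_nhds_zero_iff]
  exact ⟨Units.mk0 (valuation K x) (by simpa using hx), subset_rfl⟩

/-- **Every torsion element of the profinite completion `(K^×)^∧` is the image of a unit**: for
`K` a non-archimedean local field of characteristic `0`, `U = 𝒪_K^×` and `x ∈ (K^×)^∧` of finite
order, `x = η u` for some `u ∈ U` (classically: `(K^×)^∧ ≅ Ẑ × U` and `Ẑ` is torsion-free —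
Neukirch, *ANT* II (5.7); Serre, *Local Fields* XIV §6).  Proof: at each finite-index coordinate
`N` (index `m`) the class `x_N` has a representative in `U` (`h^n ∈ N ∩ U·ϖ^{nmℤ}` forces
`h ∈ U·ϖ^{mℤ}` and `ϖ^m ∈ N`); these representative sets are closed in the compact `U`, directed,
hence have a common point. [cite: NeukirchANT1999, Ch. II Prop. (5.7)] -/
theorem exists_mem_unitGroup_eta_eq_of_isOfFinOrder [CharZero K]
    (x : completion (GrpCat.of Kˣ)) (hx : IsOfFinOrder x) :
    ∃ u ∈ (valuation K).valuationSubring.unitGroup, (eta (GrpCat.of Kˣ)).hom u = x := by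
  classical
  letI : UniformSpace K := IsTopologicalAddGroup.rightUniformSpace K
  haveI : IsUniformAddGroup K := isUniformAddGroup_of_addCommGroup
  haveI : T2Space K := t2Space_of_isNonarchimedeanLocalField' K
  haveI : T2Space Kˣ := Units.isEmbedding_val₀.t2Space
  obtain ⟨n, hn, hxn⟩ := hx.exists_pow_eq_one
  obtain ⟨π, hπ⟩ := IsDiscreteValuationRing.exists_irreducible 𝒪[K]
  have hπ0 : (π : K) ≠ 0 := fun h => hπ.ne_zero (Subtype.ext h)
  set ϖ : Kˣ := Units.mk0 (π : K) hπ0 with hϖ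
  set U : Subgroup Kˣ := (valuation K).valuationSubring.unitGroup with hU
  -- coordinate projections
  let πc : ∀ N : FiniteIndexNormalSubgroup Kˣ, completion (GrpCat.of Kˣ) →* Kˣ ⧸ N.toSubgroup :=
    fun N => { toFun := fun y => y.1 N, map_one' := rfl, map_mul' := fun _ _ => rfl }
  have hπc : ∀ N y, πc N y = y.1 N := fun _ _ => rfl
  have hcompat : ∀ {M N : FiniteIndexNormalSubgroup Kˣ} (hMN : M ≤ N) (g : Kˣ),
      x.1 M = QuotientGroup.mk g → x.1 N = QuotientGroup.mk g := by
    intro M N hMN g hg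
    have := x.2 (homOfLE hMN)
    rw [← this, hg]
    rfl
  -- the sets of unit representatives of `x` at the coordinate `N`
  let C : FiniteIndexNormalSubgroup Kˣ → Set Kˣ := fun N =>
    (U : Set Kˣ) ∩ {g | x.1 N = QuotientGroup.mk g}
  -- (A) each `C N` is nonempty
  have hCne : ∀ N, (C N).Nonempty := by
    intro N
    set m := N.toSubgroup.index with hm
    have hm0 : m ≠ 0 := Subgroup.FiniteIndex.index_ne_zero
    let S : Subgroup Kˣ := U ⊔ Subgroup.zpowers (ϖ ^ (n * m))
    haveI : Finite (Kˣ ⧸ S) := finite_quotient_unitGroup_sup_zpowers K hπ hπ0 (mul_ne_zero hn.ne' hm0)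
    haveI : S.FiniteIndex := Subgroup.finiteIndex_of_finite_quotient
    let N' : FiniteIndexNormalSubgroup Kˣ := FiniteIndexNormalSubgroup.ofSubgroup S
    obtain ⟨h, hh⟩ := QuotientGroup.mk_surjective (x.1 (N ⊓ N'))
    -- `h ^ n ∈ N ⊓ N'`
    have hhn : h ^ n ∈ (N ⊓ N').toSubgroup := by
      rw [← QuotientGroup.eq_one_iff, QuotientGroup.mk_pow, hh, ← hπc, ← map_pow, hxn, map_one]
    have hhS : h ^ n ∈ S := hhn.2
    have hhm : h ∈ U ⊔ Subgroup.zpowers (ϖ ^ m) :=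
      mem_unitGroup_sup_zpowers_of_pow_mem K hπ hπ0 hn.ne' hhS
    rw [mem_unitGroup_sup_zpowers_iff K hπ0, ← hϖ] at hhm
    obtain ⟨u, hu, j, rfl⟩ := hhm
    refine ⟨u, hu, ?_⟩
    have hxN : x.1 N = QuotientGroup.mk (u * ϖ ^ ((m : ℤ) * j)) :=
      hcompat (inf_le_left : N ⊓ N' ≤ N) _ hh.symm
    change x.1 N = QuotientGroup.mk u
    rw [hxN]
    change (QuotientGroup.mk (u * ϖ ^ ((m : ℤ) * j)) : Kˣ ⧸ N.toSubgroup) = QuotientGroup.mk u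
    rw [QuotientGroup.eq, mul_inv_rev, inv_mul_cancel_right, inv_mem_iff, zpow_mul, zpow_natCast]
    exact Subgroup.zpow_mem _ (Subgroup.pow_index_mem N.toSubgroup ϖ) j
  -- (B) each `C N` is closed (finite-index subgroups are open, hence their cosets are closed)
  have hUc : IsCompact (U : Set Kˣ) := isCompact_unitGroup K
  have hCcl : ∀ N, IsClosed (C N) := by
    intro N
    have hNo : IsOpen (N.toSubgroup : Set Kˣ) :=
      Subgroup.isOpen_of_finiteIndex_units_localField K N.toSubgroup
    obtain ⟨g, hg⟩ := QuotientGroup.mk_surjective (x.1 N)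
    have hset : {g' : Kˣ | x.1 N = QuotientGroup.mk g'} =
        (fun g' => g⁻¹ * g') ⁻¹' (N.toSubgroup : Set Kˣ) := by
      ext g'
      simp only [Set.mem_setOf_eq, Set.mem_preimage, SetLike.mem_coe, ← hg]
      exact QuotientGroup.eq
    refine hUc.isClosed.inter ?_
    rw [hset]
    exact (Subgroup.isClosed_of_isOpen _ hNo).preimage (continuous_const.mul continuous_id)
  -- (C) the family is directed, so it has a common point by compactness of `U`
  have hCdir : Directed (· ⊇ ·) C := by
    intro N₁ N₂
    refine ⟨N₁ ⊓ N₂, ?_, ?_⟩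
    · rintro g ⟨hgU, hg⟩
      exact ⟨hgU, hcompat (inf_le_left : N₁ ⊓ N₂ ≤ N₁) g hg⟩
    · rintro g ⟨hgU, hg⟩
      exact ⟨hgU, hcompat (inf_le_right : N₁ ⊓ N₂ ≤ N₂) g hg⟩
  let N₀ : FiniteIndexNormalSubgroup Kˣ := FiniteIndexNormalSubgroup.ofSubgroup (⊤ : Subgroup Kˣ)
  haveI : Nonempty (FiniteIndexNormalSubgroup Kˣ) := ⟨N₀⟩
  obtain ⟨u, hu⟩ := IsCompact.nonempty_iInter_of_directed_nonempty_isCompact_isClosed C hCdir hCne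
    (fun N => hUc.of_isClosed_subset (hCcl N) Set.inter_subset_left) hCcl
  rw [Set.mem_iInter] at hu
  refine ⟨u, (hu N₀).1, Subtype.ext (funext fun N => ?_)⟩
  exact ((hu N).2).symm

/-! ### Injectivity of `η : K^× → (K^×)^∧` -/

/-- **`K^×` is residually finite**: `η : K^× → (K^×)^∧` is injective (`K` a non-archimedean
local field of characteristic `0`).  A non-trivial `g = u ϖ^k` is detected by `U · ϖ^{rℤ}` with
`r > |k|` if `k ≠ 0`, and by `V · ϖ^ℤ` with `V = {z ∈ U : v(z - 1) < v(u - 1)}` (an open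
subgroup of the compact `U`, so of finite index) if `k = 0`, `u ≠ 1`.  Classically: `K^×` embeds
in `Ẑ × U` (Neukirch, *ANT* II (5.7)). [cite: NeukirchANT1999, Ch. II Prop. (5.7)] -/
theorem eta_units_injective [CharZero K] :
    Function.Injective (eta (GrpCat.of Kˣ)).hom := by
  classical
  letI : UniformSpace K := IsTopologicalAddGroup.rightUniformSpace K
  haveI : IsUniformAddGroup K := isUniformAddGroup_of_addCommGroup
  refine (injective_iff_map_eq_one _).2 fun g hg => ?_
  have hall : ∀ N : FiniteIndexNormalSubgroup Kˣ, g ∈ N.toSubgroup := fun N => by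
    have h1 : ((eta (GrpCat.of Kˣ)).hom g).1 N = (1 : completion (GrpCat.of Kˣ)).1 N := by rw [hg]
    exact (QuotientGroup.eq_one_iff g).1 h1
  obtain ⟨π, hπ⟩ := IsDiscreteValuationRing.exists_irreducible 𝒪[K]
  have hπ0 : (π : K) ≠ 0 := fun h => hπ.ne_zero (Subtype.ext h)
  set ϖ : Kˣ := Units.mk0 (π : K) hπ0 with hϖ
  set U : Subgroup Kˣ := (valuation K).valuationSubring.unitGroup with hU
  obtain ⟨k, u, hu, rfl⟩ := exists_mem_unitGroup_mul_uniformizer_zpow K hπ hπ0 g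
  -- (1) the exponent vanishes
  have hk : k = 0 := by
    set r : ℕ := k.natAbs + 1 with hr
    let S : Subgroup Kˣ := U ⊔ Subgroup.zpowers (ϖ ^ r)
    haveI : Finite (Kˣ ⧸ S) := finite_quotient_unitGroup_sup_zpowers K hπ hπ0 (Nat.succ_ne_zero _)
    haveI : S.FiniteIndex := Subgroup.finiteIndex_of_finite_quotient
    have hmem : u * ϖ ^ k ∈ S := hall (FiniteIndexNormalSubgroup.ofSubgroup S)
    rw [mem_unitGroup_sup_zpowers_iff K hπ0, ← hϖ] at hmem
    obtain ⟨u', hu', j, hj⟩ := hmem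
    have hϖU : ϖ ^ (k - r * j) ∈ U := by
      have : ϖ ^ (k - r * j) = u⁻¹ * u' := by
        rw [zpow_sub, eq_inv_mul_iff_mul_eq, ← mul_assoc, hj, mul_assoc, mul_inv_cancel, mul_one]
      rw [this]
      exact mul_mem (inv_mem hu) hu'
    rw [uniformizer_zpow_mem_unitGroup_iff K hπ hπ0] at hϖU
    have hkj : k = r * j := by linarith
    have habs : k.natAbs = r * j.natAbs := by
      rw [hkj, Int.natAbs_mul]
      simp
    rcases Nat.eq_zero_or_pos j.natAbs with h0 | hpos
    · rw [hkj, Int.natAbs_eq_zero.1 h0, mul_zero]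
    · have := Nat.le_mul_of_pos_right r hpos
      omega
  rw [hk, zpow_zero, mul_one] at hall ⊢
  -- (2) `u = 1`: else `V = {z ∈ U : v(z-1) < v(u-1)}` gives a finite-index subgroup missing `u`
  by_contra hu1
  have hγ0 : valuation K ((u : K) - 1) ≠ 0 := by
    rw [Ne, map_eq_zero, sub_eq_zero]
    exact fun h => hu1 (Units.ext h)
  set γ := valuation K ((u : K) - 1) with hγ
  let V : Subgroup Kˣ :=
    { carrier := {z | z ∈ U ∧ valuation K ((z : K) - 1) < γ}
      one_mem' := ⟨one_mem U, by simpa using lt_of_le_of_ne zero_le hγ0.symm⟩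
      mul_mem' := by
        rintro a b ⟨haU, ha⟩ ⟨hbU, hb⟩
        refine ⟨mul_mem haU hbU, ?_⟩
        have hbv : valuation K (b : K) = 1 := (Valuation.mem_unitGroup_iff K (valuation K) b).1 hbU
        have : ((a * b : Kˣ) : K) - 1 = ((a : K) - 1) * b + ((b : K) - 1) := by
          push_cast; ring
        rw [this]
        refine lt_of_le_of_lt (Valuation.map_add _ _ _) (max_lt ?_ hb)
        rw [Valuation.map_mul, hbv, mul_one]
        exact ha
      inv_mem' := by
        rintro a ⟨haU, ha⟩
        refine ⟨inv_mem haU, ?_⟩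
        have hav : valuation K ((a⁻¹ : Kˣ) : K) = 1 :=
          (Valuation.mem_unitGroup_iff K (valuation K) a⁻¹).1 (inv_mem haU)
        have : ((a⁻¹ : Kˣ) : K) - 1 = -(((a⁻¹ : Kˣ) : K) * ((a : K) - 1)) := by
          rw [mul_sub, mul_one, ← Units.val_mul, inv_mul_cancel, Units.val_one]; ring
        rw [this, Valuation.map_neg, Valuation.map_mul, hav, one_mul]
        exact ha }
  have hVU : V ≤ U := fun z hz => hz.1
  have huV : u ∉ V := fun h => lt_irrefl γ h.2
  -- `V` is open in `Kˣ`
  have hVopen : IsOpen (V : Set Kˣ) := by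
    apply Subgroup.isOpen_of_mem_nhds _ (g := 1)
    have hS : {z : K | valuation K (z - 1) < γ} ∈ 𝓝 (1 : K) :=
      (IsValuativeTopology.mem_nhds_iff' (s := {z : K | valuation K (z - 1) < γ}) (x := (1 : K))).2
        ⟨Units.mk0 γ hγ0, subset_rfl⟩
    have hT : (Units.val ⁻¹' {z : K | valuation K (z - 1) < γ}) ∈ 𝓝 (1 : Kˣ) := by
      rw [Units.isEmbedding_val₀.nhds_eq_comap, Units.val_one]
      exact Filter.preimage_mem_comap hS
    have hT' : (Units.val ⁻¹' {z : K | valuation K (z - 1) < 1}) ∈ 𝓝 (1 : Kˣ) := by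
      rw [Units.isEmbedding_val₀.nhds_eq_comap, Units.val_one]
      exact Filter.preimage_mem_comap
        ((IsValuativeTopology.mem_nhds_iff' (s := {z : K | valuation K (z - 1) < 1})
          (x := (1 : K))).2 ⟨1, subset_rfl⟩)
    refine Filter.mem_of_superset (Filter.inter_mem hT hT') ?_
    rintro z ⟨hz, hz'⟩
    simp only [Set.mem_preimage, Set.mem_setOf_eq] at hz hz'
    refine ⟨(Valuation.mem_unitGroup_iff K (valuation K) z).2 ?_, hz⟩
    have : (z : K) = 1 + ((z : K) - 1) := by ring
    rw [this, Valuation.map_one_add_of_lt (valuation K) hz']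
  -- `N = V ⊔ ⟨ϖ⟩` has finite index
  let N : Subgroup Kˣ := V ⊔ Subgroup.zpowers ϖ
  have hUc : IsCompact (U : Set Kˣ) := isCompact_unitGroup K
  haveI : CompactSpace U := isCompact_iff_compactSpace.mp hUc
  have hVUo : IsOpen ((V.subgroupOf U : Subgroup U) : Set U) :=
    hVopen.preimage continuous_subtype_val
  haveI : Finite (U ⧸ V.subgroupOf U) := Subgroup.quotient_finite_of_isOpen _ hVUo
  have hle : V.subgroupOf U ≤ N.comap U.subtype := by
    intro z hz
    exact Subgroup.mem_sup_left hz
  haveI : Finite (Kˣ ⧸ N) := by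
    refine Finite.of_surjective (QuotientGroup.map (V.subgroupOf U) N U.subtype hle) fun q => ?_
    obtain ⟨y, rfl⟩ := QuotientGroup.mk_surjective q
    obtain ⟨k', w, hw, rfl⟩ := exists_mem_unitGroup_mul_uniformizer_zpow K hπ hπ0 y
    refine ⟨QuotientGroup.mk ⟨w, hw⟩, ?_⟩
    rw [QuotientGroup.map_mk, QuotientGroup.eq]
    change (w : Kˣ)⁻¹ * (w * ϖ ^ k') ∈ N
    rw [inv_mul_cancel_left]
    exact Subgroup.mem_sup_right (Subgroup.zpow_mem _ (Subgroup.mem_zpowers ϖ) k')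
  haveI : N.FiniteIndex := Subgroup.finiteIndex_of_finite_quotient
  have huN : u ∈ N := hall (FiniteIndexNormalSubgroup.ofSubgroup N)
  rw [Subgroup.mem_sup] at huN
  obtain ⟨v', hv', z, hz, hvz⟩ := huN
  obtain ⟨j, rfl⟩ := Subgroup.mem_zpowers_iff.1 hz
  have hj : ϖ ^ j ∈ U := by
    have : ϖ ^ j = v'⁻¹ * u := by rw [← hvz, inv_mul_cancel_left]
    rw [this]
    exact mul_mem (inv_mem (hVU hv')) hu
  rw [uniformizer_zpow_mem_unitGroup_iff K hπ hπ0] at hj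
  rw [hj, zpow_zero, mul_one] at hvz
  exact huV (hvz ▸ hv')

end Literature.NumberTheory.GaloisRepresentations
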